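import Literature.MathematicalPhysics.QuantumFieldTheory.Balaban1983to89.Beta.CompositionSingular
import Summits.QuantumFields.BalabanUV.Beta.FP.TorusCombRows

/-!
# `BalabanUV.Beta.FP.NestedColumnCombDead` — road «FP» for binder row D1, ROUTE T, memo `N2B-DESIGN.md` §31 (31d): **THE (β) DOOR's `hdead` ROW HOLDS FOR
# EVERY DIRECTION IN THE RANGE OF THE NESTED COMPOSITE COLUMN** — the level-1 image of the nested two-step minimiser is comb-dead, by `Q·minOp = 1` twice

WHY (memo (31d), the LEVEL-0 ASSEMBLY's directions).  leaf-02's (β) door at the (III′) literal (U18∕U20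
`NestedStepLawTorusTransportedRowsGradedLevelZeroSymULowClosedLam(W2)`) is stated along a fine background direction `h` that is AVERAGE-COARSE-COMB-DEAD:
`hdead : ∀ a x, combBondT ρ Lc M′ x = (a.1, inl a.2) → Σ_b Q₁₀ a b · h b = 0` (the hypothesis of leaf-06's `torus_t1_of_average_dead`).  R-FP-57's STEP 5
packs the door over the directions of the NESTED COMPOSITE COLUMN: for a top (level-2) direction `h̄`, the level-1 field is the coarse step's minimiser
`v := minOp S₁₁ [Q₂₀; τ₂] · (h̄, 0)` and the level-0 field is the fine minimiser `h := minOp H₀ [Q₁₀; τ₁] · (v, 0)`.  Then `Q₁₀ · h = v` and `τ₂ · v = 0`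
(`CompositionSingular.mul_minOp`: `[Q; τ] · minOp H [Q; τ] = 1`, read by blocks), and since the comb rows `τ₂` are the COORDINATE functionals of the comb
bonds (`TorusCombRows.combRowsT`), `v` VANISHES on every level-1 comb bond — which is `hdead` for `h`.  So the assembly's `hdead` is discharged with NO letter
beyond the two KKT non-degeneracies it already carries.  [folklore] block algebra; no `def`, no `def … : Prop`, nothing cited, 0 sorry; 0 estimates.

CONTENTS:
* §1 (generic index types) `fromRows_mulVec_minOp_mulVec` (`[Q; τ] · (minOp · w) = w`), `rows_minOp_mulVec_inl` (the `mulVec` reading of an2's block form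
  `GaugeFixingPropagators.mul_toCols_minOp_slice`), **`nested_column_rows`** (`Q₁₀·h = v`, `τ₁·h = 0`, `Q₂₀·v = h̄`, `τ₂·v = 0` for the nested pair),
  `apply_eq_zero_of_coordRows_mulVec_eq_zero` (coordinate rows kill ⟹ the vector vanishes on the selected slots).
* §2 (the (III′) torus types of U18∕U20) **`hdead_of_nested_column`** — `hdead` VERBATIM for `h := minOp H₀ (fromRows Q₁₀ τ₁) *ᵥ Sum.elim v 0`,
  `v := minOp S₁₁ (fromRows Q₂₀ τ₂) *ᵥ Sum.elim h̄ 0`, `τ₂` by U20's defining equation `hτ₂`; hypotheses = the two `IsUnit (kkt …).det` only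
  (leaf-05's `RelInvPeriodisedCombRows.torus_isUnit_det_kkt_combRows`-type letters, already in the door's cone).

HONEST DEPENDENCY (page 1, mandatory): continuum YM on T⁴ ⇐ BetaPertH ∧ nine spine estimates (0/9 proved); BetaPertH ⇐ (D1) ∧ (D4) ∧ CAP+tail;
G-an2-4 gates asym, D1 and NE2/3/4.  HONEST FRAMING (cell contract, verbatim): «discharging `BetaPertH` makes Bałaban's UV stability UNCONDITIONAL —
a real constructive-QFT result; it is NOT the continuum limit and NOT the Clay problem.»  ABSOLUTE RULE (cell charter, verbatim): «No internally-minted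
statement may enter as a cited fact. Every hypothesis is either kernel-proved in this package or a verbatim quotation of a PUBLISHED theorem with page
reference. The manuscript(s) under audit are NOT citable for their own disputed steps — they are the thing under adjudication; programme-internal
(2001/route/tribunal) claims are never citable.»  Nothing of Bałaban's asserted; 0∕4 row-D1 binders; NOT (T-ID), NOT SDF, NOT D1, NOT BetaPertH, NOT
continuum, NOT Clay.  Road «FP» OWNER, b2b-balaban-beta-d1-p3 gen 22, 2026-08-22.  No existing file touched.
-/

noncomputable section

open scoped BigOperators Matrix

namespace Summit.QuantumFields.BalabanUV.Beta.FP.NestedColumnCombDead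

open Matrix
open Literature.MathematicalPhysics.QuantumFieldTheory.Balaban1983to89
open Literature.MathematicalPhysics.QuantumFieldTheory.Balaban1983to89.Beta
open Literature.MathematicalPhysics.QuantumFieldTheory.Balaban1983to89.Beta.Composition (kkt)
open Literature.MathematicalPhysics.QuantumFieldTheory.Balaban1983to89.Beta.CompositionSingular (minOp mul_minOp)
open AffineAveraging (Site)
open B5Prop11Plancherel (fine)
open B6Lemma24Torus (pbox)
open OneStepResolventKernel (Fib)
open Summit.QuantumFields.BalabanUV.Beta.FP.KernelPeriodisationFib (Idx)
open Summit.QuantumFields.BalabanUV.Beta.FP.TorusCombRows (Res combRowsT combBondT)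

/-! ## §1 Generic block algebra: the rows of a KKT minimiser column -/

section Generic

variable {ν μ R κ : Type*} [Fintype ν] [Fintype μ] [Fintype R] [Fintype κ]
  [DecidableEq ν] [DecidableEq μ] [DecidableEq R] [DecidableEq κ]

/-- [folklore] **THE CONSTRAINT ROWS OF A MINIMISER COLUMN REPRODUCE THE DATA**: `[Q; τ] · (minOp H [Q; τ] · w) = w` (`CompositionSingular.mul_minOp`). -/
theorem fromRows_mulVec_minOp_mulVec (H : Matrix ν ν ℝ) (Q : Matrix μ ν ℝ) (τ : Matrix R ν ℝ)
    (hdet : IsUnit (kkt H (fromRows Q τ)).det) (w : μ ⊕ R → ℝ) :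
    fromRows Q τ *ᵥ (minOp H (fromRows Q τ) *ᵥ w) = w := by
  rw [mulVec_mulVec, mul_minOp H (fromRows Q τ) hdet, one_mulVec]

/-- [folklore] The averaging rows of the minimiser column applied to `(v, 0)` give back `v`; the slice rows give `0` — the `mulVec` reading of an2's block
form `GaugeFixingPropagators.mul_toCols_minOp_slice` (`Q ℋ₁ = 1`, `τ ℋ₁ = 0`); proved here directly from `mul_minOp` to keep the import cone at
`CompositionSingular`. -/
theorem rows_minOp_mulVec_inl (H : Matrix ν ν ℝ) (Q : Matrix μ ν ℝ) (τ : Matrix R ν ℝ)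
    (hdet : IsUnit (kkt H (fromRows Q τ)).det) (v : μ → ℝ) :
    Q *ᵥ (minOp H (fromRows Q τ) *ᵥ Sum.elim v 0) = v ∧ τ *ᵥ (minOp H (fromRows Q τ) *ᵥ Sum.elim v 0) = 0 := by
  have h := fromRows_mulVec_minOp_mulVec H Q τ hdet (Sum.elim v 0)
  rw [fromRows_mulVec] at h
  constructor
  · funext a
    have := congrFun h (Sum.inl a)
    simpa using this
  · funext x
    have := congrFun h (Sum.inr x)
    simpa using this

/-- [folklore] **THE ROWS OF THE NESTED TWO-STEP COLUMN.**  Coarse step `(S₁₁, [Q₂₀; τ₂])`, fine step `(H₀, [Q₁₀; τ₁])`, both KKT-non-degenerate; for a top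
direction `h̄` let `v := minOp S₁₁ [Q₂₀; τ₂] · (h̄, 0)` (level 1) and `h := minOp H₀ [Q₁₀; τ₁] · (v, 0)` (level 0).  Then `Q₁₀·h = v`, `τ₁·h = 0`,
`Q₂₀·v = h̄`, `τ₂·v = 0`. -/
theorem nested_column_rows (H₀ : Matrix ν ν ℝ) (Q₁₀ : Matrix μ ν ℝ) (τ₁ : Matrix R ν ℝ) {R₂ : Type*} [Fintype R₂] [DecidableEq R₂]
    (S₁₁ : Matrix μ μ ℝ) (Q₂₀ : Matrix κ μ ℝ) (τ₂ : Matrix R₂ μ ℝ)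
    (h₁ : IsUnit (kkt H₀ (fromRows Q₁₀ τ₁)).det) (h₂ : IsUnit (kkt S₁₁ (fromRows Q₂₀ τ₂)).det) (hbar : κ → ℝ)
    {v : μ → ℝ} (hv : v = minOp S₁₁ (fromRows Q₂₀ τ₂) *ᵥ Sum.elim hbar 0)
    {h : ν → ℝ} (hh : h = minOp H₀ (fromRows Q₁₀ τ₁) *ᵥ Sum.elim v 0) :
    Q₁₀ *ᵥ h = v ∧ τ₁ *ᵥ h = 0 ∧ Q₂₀ *ᵥ v = hbar ∧ τ₂ *ᵥ v = 0 := by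
  obtain ⟨hQ₁, hτ₁⟩ := rows_minOp_mulVec_inl H₀ Q₁₀ τ₁ h₁ v
  obtain ⟨hQ₂, hτ₂⟩ := rows_minOp_mulVec_inl S₁₁ Q₂₀ τ₂ h₂ hbar
  subst hv hh
  exact ⟨hQ₁, hτ₁, hQ₂, hτ₂⟩

omit [DecidableEq μ] in
/-- [folklore] **COORDINATE ROWS KILL ⟹ THE VECTOR VANISHES ON THE SELECTED SLOTS.**  If `τ x b = [e b = cb x]` for an injective slot map `e` and
`τ · v = 0`, then `v a = 0` whenever `e a` is one of the selected slots `cb x`. -/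
theorem apply_eq_zero_of_coordRows_mulVec_eq_zero {J R₂ : Type*} [DecidableEq J] [Fintype R₂] (e : μ → J) (he : Function.Injective e)
    (cb : R₂ → J) {τ : Matrix R₂ μ ℝ} (hτ : τ = Matrix.of fun x b => if e b = cb x then (1 : ℝ) else 0)
    {v : μ → ℝ} (hv : τ *ᵥ v = 0) {a : μ} {x : R₂} (hx : cb x = e a) : v a = 0 := by
  have hrow := congrFun hv x
  rw [hτ, Pi.zero_apply, mulVec, dotProduct] at hrow
  have hsum : ∑ b, (Matrix.of fun x b => if e b = cb x then (1 : ℝ) else 0) x b * v b = v a := by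
    rw [Finset.sum_eq_single a]
    · simp [hx]
    · intro b _ hb
      have hne : e b ≠ cb x := by
        rw [hx]
        exact fun hcontra => hb (he hcontra)
      simp [hne]
    · intro ha
      exact absurd (Finset.mem_univ a) ha
  rw [hsum] at hrow
  exact hrow

end Generic

/-! ## §2 The (III′) torus instance: `hdead` for the nested column, in U18∕U20's letters -/

section Torus

variable {d : ℕ} (M' : Fin (d + 1) → ℕ) {Lc : ℕ} (ρ : Site (d + 1))

/-- [folklore] The field-slot embedding `b ↦ (b.1, inl b.2)` of the torus bonds into `Idx M′ (Fib d)` is injective. -/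
theorem fieldSlot_injective :
    Function.Injective (fun b : ↥(pbox M') × Fin (d + 1) => ((b.1, Sum.inl b.2) : Idx M' (Fib d))) := by
  intro b b' hbb'
  simp only [Prod.mk.injEq, Sum.inl.injEq] at hbb'
  exact Prod.ext hbb'.1 hbb'.2

set_option synthInstance.maxSize 1024 in
/-- [folklore] **`hdead` FOR THE NESTED COLUMN** (U18∕U20's binder VERBATIM).  Fine system `(H₀, [Q₁₀; τ₁])`, coarse system `(S₁₁, [Q₂₀; τ₂])` with `τ₂` the
level-1 comb coordinate rows (`hτ₂`, U20's defining equation), both KKT-non-degenerate; for a top direction `h̄ : κ → ℝ` the nested column's level-0 field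
`h := minOp H₀ [Q₁₀; τ₁] · (minOp S₁₁ [Q₂₀; τ₂] · (h̄, 0), 0)` is AVERAGE-COARSE-COMB-DEAD: `Σ_b Q₁₀ a b · h b = 0` at every level-1 comb bond `a`. -/
theorem hdead_of_nested_column {κ : Type*} [Fintype κ] [DecidableEq κ]
    (H₀ : Matrix (↥(pbox (fine Lc M')) × Fin (d + 1)) (↥(pbox (fine Lc M')) × Fin (d + 1)) ℝ)
    (Q₁₀ : Matrix (↥(pbox M') × Fin (d + 1)) (↥(pbox (fine Lc M')) × Fin (d + 1)) ℝ)
    (τ₁ : Matrix (Res ρ Lc (fine Lc M')) (↥(pbox (fine Lc M')) × Fin (d + 1)) ℝ)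
    (S₁₁ : Matrix (↥(pbox M') × Fin (d + 1)) (↥(pbox M') × Fin (d + 1)) ℝ)
    (Q₂₀ : Matrix κ (↥(pbox M') × Fin (d + 1)) ℝ)
    {τ₂ : Matrix (Res ρ Lc M') (↥(pbox M') × Fin (d + 1)) ℝ}
    (hτ₂ : τ₂ = (combRowsT ρ Lc M').submatrix id (fun b : ↥(pbox M') × Fin (d + 1) => ((b.1, Sum.inl b.2) : Idx M' (Fib d))))
    (h₁ : IsUnit (kkt H₀ (fromRows Q₁₀ τ₁)).det) (h₂ : IsUnit (kkt S₁₁ (fromRows Q₂₀ τ₂)).det)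
    (hbar : κ → ℝ)
    {v : ↥(pbox M') × Fin (d + 1) → ℝ} (hv : v = minOp S₁₁ (fromRows Q₂₀ τ₂) *ᵥ Sum.elim hbar 0)
    {h : ↥(pbox (fine Lc M')) × Fin (d + 1) → ℝ} (hh : h = minOp H₀ (fromRows Q₁₀ τ₁) *ᵥ Sum.elim v 0) :
    ∀ (a : ↥(pbox M') × Fin (d + 1)) (x : Res ρ Lc M'),
      combBondT ρ Lc M' x = ((a.1, Sum.inl a.2) : Idx M' (Fib d)) → ∑ b : ↥(pbox (fine Lc M')) × Fin (d + 1), Q₁₀ a b * h b = 0 := by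
  intro a x hx
  obtain ⟨hQ₁, -, -, hτ₂v⟩ := nested_column_rows H₀ Q₁₀ τ₁ S₁₁ Q₂₀ τ₂ h₁ h₂ hbar hv hh
  -- the sum IS the `a`-entry of `Q₁₀ · h = v`
  have hsum : ∑ b : ↥(pbox (fine Lc M')) × Fin (d + 1), Q₁₀ a b * h b = v a := by
    have := congrFun hQ₁ a
    rw [mulVec, dotProduct] at this
    exact this
  rw [hsum]
  -- the comb rows are the coordinate functionals of the comb bonds
  have hτ₂' : τ₂ = Matrix.of fun (x : Res ρ Lc M') (b : ↥(pbox M') × Fin (d + 1)) =>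
      if ((b.1, Sum.inl b.2) : Idx M' (Fib d)) = combBondT ρ Lc M' x then (1 : ℝ) else 0 := by
    rw [hτ₂]
    ext x b
    simp [combRowsT, Matrix.submatrix]
  exact apply_eq_zero_of_coordRows_mulVec_eq_zero (fun b : ↥(pbox M') × Fin (d + 1) => ((b.1, Sum.inl b.2) : Idx M' (Fib d)))
    (fieldSlot_injective M') (combBondT ρ Lc M') hτ₂' hτ₂v hx

end Torus

end Summit.QuantumFields.BalabanUV.Beta.FP.NestedColumnCombDead

end
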